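import Mathlib
import Literature.MathematicalPhysics.KineticTheory.HardSphereEuler

/-!
drefute probes for `stub_azumaHoeffding` (S5) / `stub_compensatorDefect` (S6) of line
`dynkin-azuma-collision-innovations` (crux KineticFluxLdDecay, stmt-AtomisticToContinuum-10967).
`lean check` rc 0.  Observations recorded in Negative-notes/stub_azumaHoeffding.md:

* `predictablePart f ℱ μ n = ∑ i ∈ range n, μ[f (i+1) - f i | ℱ i]` (no `f 0`), so `martingalePart f ℱ μ 0 = f 0`
  (example below) — `h0` in S5 is load-bearing.
* `ProbabilityTheory.HasSubgaussianMGF.sum_of_hasCondSubgaussianMGF` needs `[StandardBorelSpace Ω]`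
  (see its `#check` output: binders `[inst : StandardBorelSpace Ω] … [IsZeroOrProbabilityMeasure μ]`), which the stub
  does not assume; and `StandardBorelSpace (Config (N+1) (Fin 3) T3)` is NOT found by `inferInstance`
  (the commented example fails with `failed to synthesize`; `StandardBorelSpace (T3 × V3)` alone is found) —
  so prove S5 kernel-free (cosh bound below) or hand-build the pi instance.
* `MeasurableSpace.comap_const`: the comap of a constant map is `⊥`, hence `causalSigma … 0 = ⊥` in the skeleton
  (its `record … 0` is the constant `fun _ => (false, default)`), forcing `ℱ 0 = ⊥` in S6 — compatible (`procX … 0 = 0`).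
-/

open MeasureTheory ProbabilityTheory

#check @ProbabilityTheory.HasSubgaussianMGF.sum_of_hasCondSubgaussianMGF

example {Ω : Type*} {m0 : MeasurableSpace Ω} (μ : Measure Ω) (ℱ : Filtration ℕ m0) (f : ℕ → Ω → ℝ) :
    martingalePart f ℱ μ 0 = f 0 := by
  simp [martingalePart, predictablePart]

example {α β : Type*} [MeasurableSpace β] (b : β) :
    MeasurableSpace.comap (fun _ : α => b) inferInstance = ⊥ :=
  MeasurableSpace.comap_const b

/-- The elementary inequality behind the kernel-free conditional Hoeffding step of S5:
`cosh x ≤ exp (x²/2)` (Mathlib). With `|d| ≤ 2R`, `E[d|𝒢] = 0`, convexity of `exp` on `[-2R, 2R]` gives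
`E[e^{td}|𝒢] ≤ cosh (2tR) ≤ exp (2 t² R²)`, i.e. exactly the stub's constant `2 n R² t²` after `n` steps. -/
example (t R : ℝ) : Real.cosh (2 * t * R) ≤ Real.exp (2 * t ^ 2 * R ^ 2) := by
  have h := Real.cosh_le_exp_half_sq (2 * t * R)
  calc Real.cosh (2 * t * R) ≤ Real.exp ((2 * t * R) ^ 2 / 2) := h
    _ = Real.exp (2 * t ^ 2 * R ^ 2) := by ring_nf

/-- Pointwise convexity bound used for the conditional step: for `|x| ≤ c`, `0 < c`,
`exp (t x) ≤ cosh (t c) + x * sinh (t c) / c`. -/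
example (t c x : ℝ) (hc : 0 < c) (hx : |x| ≤ c) :
    Real.exp (t * x) ≤ Real.cosh (t * c) + x * (Real.sinh (t * c) / c) := by
  -- convex combination: t x = λ (t c) + (1 - λ) (-(t c)) with λ = (c + x)/(2c)
  have hx' := abs_le.1 hx
  set lam : ℝ := (c + x) / (2 * c) with hlam
  have h0 : 0 ≤ lam := by rw [hlam]; apply div_nonneg <;> linarith
  have h1 : lam ≤ 1 := by rw [hlam, div_le_one (by linarith)]; linarith
  have hconv := (convexOn_exp).2 (Set.mem_univ (t * c)) (Set.mem_univ (-(t * c))) h0 (by linarith : 0 ≤ 1 - lam)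
    (by ring : lam + (1 - lam) = 1)
  simp only [smul_eq_mul] at hconv
  have hid : lam * (t * c) + (1 - lam) * -(t * c) = t * x := by
    rw [hlam]; field_simp; ring
  rw [hid] at hconv
  refine hconv.trans (le_of_eq ?_)
  rw [Real.cosh_eq, Real.sinh_eq, hlam]
  field_simp
  ring

-- FAILS (kept as a comment; `lean check` of the uncommented line reports `failed to synthesize`):
-- noncomputable example (N : ℕ) :
--     StandardBorelSpace (Literature.Analysis.FluidPDE.Config (N + 1) (Fin 3)
--       Literature.MathematicalPhysics.KineticTheory.T3) := inferInstance
noncomputable example :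
    StandardBorelSpace (Literature.MathematicalPhysics.KineticTheory.T3 ×
      Literature.MathematicalPhysics.KineticTheory.V3) := inferInstance
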